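import Summits.BirchSwinnertonDyer.BirchSwinnertonDyer.Theorems.SignedLowerHalvesSprungLowerDivisibilityAtThreeCokerBoundByMassSkeletonLocallyCyclic
import Summits.BirchSwinnertonDyer.BirchSwinnertonDyer.Theorems.SignedLowerHalvesSprungLowerDivisibilityAtThreeCokerBoundByMassOfThm714
import HarnessLib

/-!
# Crux `SprungLowerDivisibilityAtThree` (item stmt-BirchSwinnertonDyer-19875; twin route `PrintX8VSC`: cruxes K′ 23732 / C′ 23733,
# held pack `HeldFactsIotaDoorX8Contra` 23731), line `chromatic-common-zeros`: F-α♮′ WITHOUT KATO'S THEOREM 12.4 —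
# the cokernel bound of the print-keyed `ι`-door from TWO outside named facts {Poitou–Tate functional model, Matar 2020 Thm. 1.1}
# + the route's guard Sprung 2012 Thm. 7.14

Cell `bsd-ssimc` (host), width seat `cruxlead-stmt-BirchSwinnertonDyer-19875-w3` (gen 10) under the 19875 LEAD; `--supports`
stmt-BirchSwinnertonDyer-19875 `--as helper`; theorems only; closes NO item. Sequel of w2 g10's
`…CokerBoundByMassOfThm714.lean` §4 (`cokerBoundIotaOffT_contra_of_poitouTate_of_thm714 (hPT) (h124) (hMatar) (h714)` = the registered
door-stub text of the K′/C′ line skeletons from THREE facts + the guard) and of this seat's `…CokerBoundByMassSkeletonLocallyCyclic.lean`.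

WHAT CHANGES. Kato 2004 Thm. 12.4 entered F-α♮′ at exactly one point: (M1) `massCotorsion_contraFamily_of_poitouTate` used clause (3)
«`𝐇¹_Γ(T_pW)` free of rank one» to feed a CYCLIC `H = Λ·h₀` to the mass skeleton. The skeleton is an inequality of lengths at ONE height-one
prime `𝔭`, and (`min_lengthAt_le_fine_add_torsion_of_massSkeleton_of_smul`) it only needs `H` cyclic on `h₀` UP TO an `s ∉ 𝔭`. Inside the
crux that is free of charge: the `♯` Coleman–Kato map of the crux's own package `Cs : SharpFlatColemanKatoDataContra … Chroma.sharp I` is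
INJECTIVE on `I.H` because `L♯ ≠ 0` on class X8 (`Cs.colMap_injective`, `ChromaticBothColours.ClassX8.chromaticL_ne_zero` — Sprung 2017
Thm. 4.13, a tree theorem), so `I.H ↪ Λ`; `I.H ≠ 0` because otherwise the exact sequence (3) of the package (`Cs.exact`) would embed `Λ`
into the torsion module `X♯(γ⁻¹)` (torsion by the guard Thm. 7.14, keying-immune); and a non-zero submodule of the UFD `Λ` is
`𝔭`-locally cyclic at every height-one `𝔭` (`exists_smul_cyclic_of_injective`). No finite generation, no freeness, no rank is used.

* §1 `min_lengthAt_le_fine_add_torsion_of_poitouTate_functionalModel_of_smul` — (M1) at one prime from a Poitou–Tate datum in the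
  functional model, `H` cyclic up to `s ∉ 𝔭` (twin of w2 g9's `…_of_poitouTate_functionalModel`).
* §2 `massCotorsion_contraFamily_of_poitouTate_of_injective (hPT)` — (M1) for the print-keyed family on class X8, for a GIVEN pinned `I`
  with a displayed INJECTIVE `Λ`-linear `I.H → Λ` and `I.H ≠ 0` — NO `Kato2004.thm12_4`, NO `nonempty_iwasawaH1Data`.
* §3 `nontrivial_iwasawaH1_of_contraPackage` — `I.H ≠ 0` from a `♯`-package whose dual `X♯(γ⁻¹)` is torsion;
  **`cokerBoundIotaOffT_contra_of_poitouTate_of_thm714' (hPT) (hMatar) (h714)`** = the REGISTERED F-α♮′ text (door input of K′/C′), from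
  TWO outside named facts + the guard. Reading for the pen / referee: `HeldFactsIotaDoorX8Contra` (23731 = PT ∧ Kato 12.4 ∧ Matar) can
  drop its middle conjunct; the door closers `iotaDoorContra_{sporadic,posLevel}_of_heldPack_of_thm714` (LEAD g7) re-thread in one line.

HONEST FRAMING: implications between typed statements; the two remaining outside facts (Sprung's (3)/(7.18)_∞ in the functional model;
Matar 2020 Thm. 1.1) are printed theorems typed statement-only; K′, C′, R♮′, K1, leaf X8 and BSD are NOT proved here. Kato's Thm. 12.4 is
of course TRUE — it is merely no longer an input of this door.

References: [Kato2004Asterisque] Thm. 12.4 (p. 221) (removed), (17.13.1) (p. 280); [Sprung2012] Def. 6.1, Props. 7.3/7.6, Def. 7.9–7.13,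
Thm. 7.14 with (3) (pp. 1495–1504); [Sprung2017] Thm. 4.13; [Kobayashi2003] Prop. 7.1, Thm. 7.3 (pp. 12–13); [Matar2020] Thm. 1.1;
[BourbakiAC5to7] VII §4.4; tree: `…CokerBoundByMassSkeletonLocallyCyclic`, `…CokerBoundByMassKeying` §3, `…CokerBoundByMassPoitouTate`,
`…CokerBoundByMassOfThm714` §1–§2, §4.
-/

set_option linter.dupNamespace false
set_option autoImplicit false

noncomputable section

open scoped Classical NumberField MatrixGroups ModularForm

open NumberField IsDedekindDomain CongruenceSubgroup WeierstrassCurve Field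
  Literature.NumberTheory.EllipticCurves Literature.NumberTheory.EllipticCurves.ModularForms
  Literature.NumberTheory.EllipticCurves.ZpExtension Literature.NumberTheory.EllipticCurves.Sprung2017
  Literature.NumberTheory.EllipticCurves.Sprung2012 Literature.NumberTheory.EllipticCurves.Rank1Residual
  Literature.NumberTheory.EllipticCurves.IwasawaAlgebra Literature.NumberTheory.EllipticCurves.Kato2004
  Literature.NumberTheory.EllipticCurves.Module
  Summit.BirchSwinnertonDyer.BirchSwinnertonDyer.Theorems

namespace Summit.BirchSwinnertonDyer.BirchSwinnertonDyer.Theorems.ChromaticCommonZeros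

/-! ### §1 (M1) at one prime from a Poitou–Tate datum in the functional model, `H` cyclic up to `s ∉ 𝔭` -/

section FunctionalModel

universe v₁ v₂ v₃ v₄ v₅

/-- **(M1) AT ONE PRIME FROM A POITOU–TATE DATUM IN THE FUNCTIONAL MODEL, `𝔭`-LOCALLY CYCLIC SOURCE** — w2 g9's
`min_lengthAt_le_fine_add_torsion_of_poitouTate_functionalModel` with «`H = Λ·h₀`» weakened to «`s·H ⊆ Λ·h₀` for some `s ∉ 𝔭`»: `W/ℚ` globally
minimal, `p ≠ 2` good supersingular, `κ`, `v ∋ p`, a local lift `g`, a Honda system; over ABSTRACT `Λ`-modules `loc : H → P` (functional model)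
with `loc h₀ ≠ 0`, `toX : P → X` exact at `P`, `πY : X ↠ Y` with `ker πY = range toX`, `π• : X ↠ D•` with `ker π• = toX(Ker Col^•)`; THEN at
the height-one `𝔭 ∌ T` with `s ∉ 𝔭`: `min(ℓ_𝔭 D♯, ℓ_𝔭 D♭) ≤ ℓ_𝔭 Y + ℓ_𝔭(tors X)`. The joint Coleman map, its injectivity, `ℓ_𝔭(Λ²/im J) = 0`,
`Ker Col^• = ker(• ∘ J)` from the tree; the algebra is `min_lengthAt_le_fine_add_torsion_of_massSkeleton_of_smul`.
[cite: Kato2004Asterisque, (17.13.1) (pp. 279–280)] [cite: Kobayashi2003, Prop. 7.1, Thm. 7.3 (pp. 12–13)]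
[cite: Sprung2012, Props. 7.3/7.6 (pp. 1500–1501), Def. 7.9, 7.11 (p. 1503), Def. 7.13 (p. 1504)] [cite: BourbakiAC5to7, VII §4.4] -/
theorem min_lengthAt_le_fine_add_torsion_of_poitouTate_functionalModel_of_smul
    (W : WeierstrassCurve ℚ) [W.IsElliptic] [W.IsGloballyMinimal] (p : ℕ) [Fact p.Prime] (hp2 : p ≠ 2)
    (hgood : W.HasGoodReductionAtPrime p) (hap : (p : ℤ) ∣ W.frobeniusTrace p) (κ : ZpExtension ℚ p)
    {v : HeightOneSpectrum (𝓞 ℚ)} (hpv : (p : 𝓞 ℚ) ∈ v.asIdeal)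
    {g : Field.absoluteGaloisGroup (v.adicCompletion ℚ)}
    (hg : κ.IsTopGenerator (resGalOfEmb (closureEmb (K := ℚ) (v.adicCompletion ℚ)) g))
    {cneg : localPoints W (v.adicCompletion ℚ)} {c : ℕ → localPoints W (v.adicCompletion ℚ)}
    (hH : IsHondaSystem κ (closureEmb (K := ℚ) (v.adicCompletion ℚ)) W (W.frobeniusTrace p) g cneg c) :
    letI := moduleOfGenerator κ (closureEmb (K := ℚ) (v.adicCompletion ℚ)) W hg
    ∀ {H : Type v₁} {X : Type v₂} {Y : Type v₃} {Ds : Type v₄} {Df : Type v₅}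
      [AddCommGroup H] [Module (IwasawaAlgebra p) H] [AddCommGroup X] [Module (IwasawaAlgebra p) X]
      [AddCommGroup Y] [Module (IwasawaAlgebra p) Y] [AddCommGroup Ds] [Module (IwasawaAlgebra p) Ds]
      [AddCommGroup Df] [Module (IwasawaAlgebra p) Df]
      (loc : H →ₗ[IwasawaAlgebra p]
        (localTowerPointsOfEmb κ (closureEmb (K := ℚ) (v.adicCompletion ℚ)) W →+ ℤ_[p]))
      (toX : (localTowerPointsOfEmb κ (closureEmb (K := ℚ) (v.adicCompletion ℚ)) W →+ ℤ_[p]) →ₗ[IwasawaAlgebra p] X),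
      Function.Exact loc toX →
    ∀ (πY : X →ₗ[IwasawaAlgebra p] Y), Function.Surjective πY → LinearMap.ker πY = LinearMap.range toX →
    ∀ (πs : X →ₗ[IwasawaAlgebra p] Ds), Function.Surjective πs →
      (∀ x, x ∈ LinearMap.ker πs ↔
        x ∈ toX '' colemanKer κ (closureEmb (K := ℚ) (v.adicCompletion ℚ)) W (W.frobeniusTrace p) g c Chroma.sharp) →
    ∀ (πf : X →ₗ[IwasawaAlgebra p] Df), Function.Surjective πf →
      (∀ x, x ∈ LinearMap.ker πf ↔
        x ∈ toX '' colemanKer κ (closureEmb (K := ℚ) (v.adicCompletion ℚ)) W (W.frobeniusTrace p) g c Chroma.flat) →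
    ∀ (h₀ : H) (s : IwasawaAlgebra p), (∀ h : H, ∃ r : IwasawaAlgebra p, s • h = r • h₀) → loc h₀ ≠ 0 →
    ∀ (𝔭 : PrimeSpectrum (IwasawaAlgebra p)), 𝔭.asIdeal.height = 1 →
      (PowerSeries.X : IwasawaAlgebra p) ∉ 𝔭.asIdeal → s ∉ 𝔭.asIdeal →
      min (Module.lengthAt (IwasawaAlgebra p) Ds 𝔭) (Module.lengthAt (IwasawaAlgebra p) Df 𝔭) ≤
        Module.lengthAt (IwasawaAlgebra p) Y 𝔭 +
          Module.lengthAt (IwasawaAlgebra p) (Submodule.torsion (IwasawaAlgebra p) X) 𝔭 := by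
  letI := moduleOfGenerator κ (closureEmb (K := ℚ) (v.adicCompletion ℚ)) W hg
  intro H X Y Ds Df _ _ _ _ _ _ _ _ _ _ loc toX hexact πY hπY hkerY πs hπs hkers πf hπf hkerf h₀ s hcyc hloc 𝔭 h𝔭 hT hs
  obtain ⟨J, hJ, hinj, -, hcoker⟩ :=
    exists_linearMap_isColemanPair_cokernel_of_hondaSystem_rat W p hp2 hgood hap κ hpv hg hH
  -- `Ker Col^• = ker(• ∘ J)` by uniqueness of Coleman values
  have hker : ∀ (col : Chroma) (z : localTowerPointsOfEmb κ (closureEmb (K := ℚ) (v.adicCompletion ℚ)) W →+ ℤ_[p]),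
      z ∈ colemanKer κ (closureEmb (K := ℚ) (v.adicCompletion ℚ)) W (W.frobeniusTrace p) g c col ↔
        chromaticL col (J z).1 (J z).2 = 0 := by
    intro col z
    rw [mem_colemanKer_iff]
    constructor
    · rintro ⟨Ls, Lf, hz, h0⟩
      obtain ⟨h1, h2⟩ := IsColemanPair.unique κ (closureEmb (K := ℚ) (v.adicCompletion ℚ)) W hap hz (hJ z)
      rwa [h1, h2] at h0
    · intro h0
      exact ⟨(J z).1, (J z).2, hJ z, h0⟩
  have hkers' : LinearMap.ker πs = (LinearMap.ker (LinearMap.fst _ _ _ ∘ₗ J)).map toX := by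
    ext x
    rw [hkers x, Submodule.mem_map]
    constructor
    · rintro ⟨z, hz, rfl⟩
      refine ⟨z, ?_, rfl⟩
      rw [LinearMap.mem_ker, LinearMap.comp_apply, LinearMap.fst_apply]
      simpa only [chromaticL_sharp] using (hker Chroma.sharp z).mp hz
    · rintro ⟨z, hz, rfl⟩
      refine ⟨z, ?_, rfl⟩
      rw [LinearMap.mem_ker, LinearMap.comp_apply, LinearMap.fst_apply] at hz
      exact (hker Chroma.sharp z).mpr (by simpa only [chromaticL_sharp] using hz)
  have hkerf' : LinearMap.ker πf = (LinearMap.ker (LinearMap.snd _ _ _ ∘ₗ J)).map toX := by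
    ext x
    rw [hkerf x, Submodule.mem_map]
    constructor
    · rintro ⟨z, hz, rfl⟩
      refine ⟨z, ?_, rfl⟩
      rw [LinearMap.mem_ker, LinearMap.comp_apply, LinearMap.snd_apply]
      simpa only [chromaticL_flat] using (hker Chroma.flat z).mp hz
    · rintro ⟨z, hz, rfl⟩
      refine ⟨z, ?_, rfl⟩
      rw [LinearMap.mem_ker, LinearMap.comp_apply, LinearMap.snd_apply] at hz
      exact (hker Chroma.flat z).mpr (by simpa only [chromaticL_flat] using hz)
  exact min_lengthAt_le_fine_add_torsion_of_massSkeleton_of_smul loc toX hexact J hinj πY hπY hkerY πs hπs hkers' πf hπf hkerf'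
    h₀ hloc 𝔭 h𝔭 hs hcyc (hcoker 𝔭 hT)

end FunctionalModel

/-! ### §2 (M1) for the print-keyed family on class X8, for a GIVEN pinned `I` embedded in `Λ` — no Kato 12.4 -/

section Natural

/-- **(M1) «chromatic excess ≤ cotorsion» for the PRINT-KEYED family from the typed Poitou–Tate input, for a GIVEN pinned `I` with a
displayed INJECTIVE `Λ`-linear map `φ : I.H → Λ` and `I.H ≠ 0`** (NO `Kato2004.thm12_4`, NO `nonempty_iwasawaH1Data`): on class X8, in the
cyclotomic/Honda frame, for every natural-keyed (`γ⁻¹`) Pontryagin-dual data `S'` of `Sel_{p^∞}(E/ℚ_∞)`, `Ds', Df'` of `Sel♯, Sel♭` and `Y'` of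
`Sel₀`, at every height-one `𝔭 ∌ p, T`: `min(ℓ_𝔭 Ds'.X, ℓ_𝔭 Df'.X) ≤ ℓ_𝔭 Y'.X + ℓ_𝔭(tors_Λ S'.X)`. Proof: `I.H` is `𝔭`-locally cyclic on some
`h₀ ≠ 0` (`exists_smul_cyclic_of_injective`, UFD `Λ`); the fact `thm714seq_sharpFlat_poitouTate_functionalModel` supplies `loc` (injective, so
`loc h₀ ≠ 0`), `toX`, `πY`, `π♯`, `π♭`; §1 does the rest. CONDITIONAL on the one named fact.
[cite: Sprung2012, Thm. 7.14 proof with (3) (p. 1504), Def. 7.9, 7.11 (p. 1503), Def. 7.13 (p. 1504)] [cite: Kobayashi2003, (7.16)–(7.20), Prop. 7.1, Thm. 7.3 i) (pp. 12–13)]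
[cite: Kato2004Asterisque, §12.2 (p. 220)] [cite: BourbakiAC5to7, VII §4.4] -/
theorem massCotorsion_contraFamily_of_poitouTate_of_injective (hPT : thm714seq_sharpFlat_poitouTate_functionalModel)
    (W : WeierstrassCurve ℚ) [W.IsElliptic] [W.IsGloballyMinimal] (p : ℕ) [Fact p.Prime]
    [ContinuousSMul ℤ_[p] (W.tateModule p)]
    (hX : ClassX8 W p) {κ : ZpExtension ℚ p} {γ : Field.absoluteGaloisGroup ℚ}
    (hκ : κ.IsCyclotomic) (hγ : κ.IsTopGenerator γ)
    {v : HeightOneSpectrum (𝓞 ℚ)} (hv : (p : 𝓞 ℚ) ∈ v.asIdeal)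
    {g : Field.absoluteGaloisGroup (v.adicCompletion ℚ)}
    (hg : κ.IsTopGenerator (resGalOfEmb (closureEmb (K := ℚ) (v.adicCompletion ℚ)) g))
    {cneg : localPoints W (v.adicCompletion ℚ)} {c : ℕ → localPoints W (v.adicCompletion ℚ)}
    (hH : IsHondaSystem κ (closureEmb (K := ℚ) (v.adicCompletion ℚ)) W (W.frobeniusTrace p) g cneg c)
    (I : Kato2004.IwasawaH1Data W p κ γ) (φ : I.H →ₗ[IwasawaAlgebra p] IwasawaAlgebra p) (hφ : Function.Injective φ)
    (hI0 : Nontrivial I.H)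
    (S' : W.SelmerDualData κ γ⁻¹)
    (Ds' : SharpFlatSelmerDualData W κ γ⁻¹ (closureEmb (K := ℚ) (v.adicCompletion ℚ)) (W.frobeniusTrace p) g c
      Chroma.sharp)
    (Df' : SharpFlatSelmerDualData W κ γ⁻¹ (closureEmb (K := ℚ) (v.adicCompletion ℚ)) (W.frobeniusTrace p) g c
      Chroma.flat)
    (Y' : W.FineSelmerDualData κ γ⁻¹) (𝔭 : PrimeSpectrum (IwasawaAlgebra p)) (h𝔭 : 𝔭.asIdeal.height = 1)
    (hT𝔭 : (PowerSeries.X : IwasawaAlgebra p) ∉ 𝔭.asIdeal) :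
    min (Module.lengthAt (IwasawaAlgebra p) Ds'.X 𝔭) (Module.lengthAt (IwasawaAlgebra p) Df'.X 𝔭) ≤
      Module.lengthAt (IwasawaAlgebra p) Y'.X 𝔭 +
        Module.lengthAt (IwasawaAlgebra p) (Submodule.torsion (IwasawaAlgebra p) S'.X) 𝔭 := by
  obtain ⟨hp3, ⟨hgood, hap⟩, -⟩ := hX
  subst hp3
  have hp2 : (3 : ℕ) ≠ 2 := by decide
  letI := moduleOfGenerator κ (closureEmb (K := ℚ) (v.adicCompletion ℚ)) W hg
  -- `I.H` is `𝔭`-locally cyclic on some `h₀ ≠ 0`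
  haveI := hI0
  obtain ⟨h₀, h₀ne, s, hs, hcyc⟩ := exists_smul_cyclic_of_injective φ hφ 𝔭 h𝔭
  -- the typed Poitou–Tate functional model
  obtain ⟨loc, toX, hinj, hexact, hY, hcol⟩ := hPT W 3 hp2 hgood hap κ γ hκ hγ v hv g hg cneg c hH I S'
  have hloc : loc h₀ ≠ 0 := fun h0 => h₀ne (hinj (by rw [h0, map_zero]))
  obtain ⟨πY, hπY, hkerY⟩ := hY Y'
  obtain ⟨πs, hπs, hkers⟩ := hcol Chroma.sharp Ds'
  obtain ⟨πf, hπf, hkerf⟩ := hcol Chroma.flat Df'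
  exact min_lengthAt_le_fine_add_torsion_of_poitouTate_functionalModel_of_smul W 3 hp2 hgood hap κ hv hg hH loc toX hexact
    πY hπY hkerY πs hπs hkers πf hπf hkerf h₀ s hcyc hloc 𝔭 h𝔭 hT𝔭 hs

end Natural

/-! ### §3 F-α♮′ from TWO outside facts + the guard: `I.H ↪ Λ` and `I.H ≠ 0` come from the crux's own `♯` package -/

section ContraStub

/-- **`𝐇¹ ≠ 0` from a `♯`-package with torsion dual.** If `Cs : SharpFlatColemanKatoDataContra … Chroma.sharp I` is a print-keyed
Coleman–Kato package on the pinned `I` and some `γ⁻¹`-keyed dual datum `D′` of `Sel♯` has `Λ`-TORSION `D′.X` (Sprung Thm. 7.14), then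
`I.H` is non-trivial: were `I.H = 0`, the exact sequence (3) of the package (`Cs.exact D′ Y′`: `𝐇¹ →^{Col} Λ →^{j} X♯ → X₀ → 0`) would
make `j : Λ → D′.X` injective, and `Λ` does not embed in a torsion module. [cite: Sprung2012, Thm. 7.14 with (3) (p. 1504)]
[cite: Kato2004Asterisque, Thm. 12.4 (2) (p. 221) (the statement this replaces)] -/
theorem nontrivial_iwasawaH1_of_contraPackage {W : WeierstrassCurve ℚ} [W.IsElliptic] [W.IsGloballyMinimal] {p : ℕ}
    [Fact p.Prime] [ContinuousSMul ℤ_[p] (W.tateModule p)] [Module.Free ℤ_[p] (W.tateModule p)]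
    [Module.Finite ℤ_[p] (W.tateModule p)] {N : ℕ} {f : CuspForm (Gamma0 N) 2} {ϖ : ℚ}
    {κ : ZpExtension ℚ p} {γ : Field.absoluteGaloisGroup ℚ} {E : Type} [Field E] [Algebra ℚ E]
    {ι : AlgebraicClosure ℚ →ₐ[ℚ] AlgebraicClosure E} {ap : ℤ} {g : Field.absoluteGaloisGroup E}
    {c : ℕ → localPoints W E} {I : Kato2004.IwasawaH1Data W p κ γ}
    (Cs : SharpFlatColemanKatoDataContra W p f ϖ κ γ ι ap g c Chroma.sharp I)
    (D' : SharpFlatSelmerDualData W κ γ⁻¹ ι ap g c Chroma.sharp) (hD' : Module.IsTorsion (IwasawaAlgebra p) D'.X)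
    (Y' : W.FineSelmerDualData κ γ⁻¹) : Nontrivial I.H := by
  by_contra hnt
  rw [not_nontrivial_iff_subsingleton] at hnt
  obtain ⟨j, k, hcj, -, -⟩ := Cs.exact D' Y'
  -- `range colMap = ⊥`, so `j` is injective
  have hjinj : Function.Injective j := by
    rw [← LinearMap.ker_eq_bot, LinearMap.exact_iff.mp hcj, LinearMap.range_eq_bot]
    ext x
    rw [Subsingleton.elim x 0, map_zero, LinearMap.zero_apply]
  -- `Λ` does not embed in the torsion module `D'.X`
  obtain ⟨a, ha⟩ := @hD' (j 1)
  rw [Submonoid.smul_def] at ha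
  have ha0 : ((a : IwasawaAlgebra p) : IwasawaAlgebra p) = 0 := by
    apply hjinj
    rw [map_zero, ← ha, ← map_smul, smul_eq_mul, mul_one]
  exact nonZeroDivisors.coe_ne_zero a ha0

/-- **THE PRINT-KEYED COKERNEL BOUND F-α♮′ from TWO outside named facts + the guard `h714` — NO `Kato2004.thm12_4`** (the registered
door input of the K′/C′ line skeletons on 23732/23733, conclusion text of `cokerBoundIotaOffT_contra_of_poitouTate_of_thm714` VERBATIM): same
binders (class X8, cyclotomic `κ`/`γ`, Honda frame, newform, Sprung pair, `I`, Contra packages `Cs, Cf` with `Cs.Z = Cf.Z`, `Y′` of key `γ⁻¹`,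
height-one `𝔭 ∌ p, T`, the common-zero clause), from `thm714seq_sharpFlat_poitouTate_functionalModel`,
`matar2020_thm11_selmerDualTorsion_pseudoIso_fineSelmerDual` and `thm714_sharpFlatSelmerDual_finite_torsion`. Proof = w2 g10's §4 with
(M1)-contra supplied by `massCotorsion_contraFamily_of_poitouTate_of_injective` for THE CRUX'S OWN `I`, embedded in `Λ` by `Cs.colMap`
(injective as `L♯ ≠ 0` on X8, Sprung 2017 Thm. 4.13) and non-trivial by `nontrivial_iwasawaH1_of_contraPackage` (`X♯(γ⁻¹)` torsion by Thm. 7.14).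
[cite: Sprung2012, Thm. 7.14 proof with (3) (p. 1504), Def. 7.9–7.13 (pp. 1503–1504)] [cite: Sprung2017, Thm. 4.13] [cite: Matar2020, Thm. 1.1]
[cite: Kato2004Asterisque, (17.13.1) (p. 280)] [cite: BourbakiAC5to7, VII §4.4] -/
theorem cokerBoundIotaOffT_contra_of_poitouTate_of_thm714' (hPT : thm714seq_sharpFlat_poitouTate_functionalModel)
    (hMatar : matar2020_thm11_selmerDualTorsion_pseudoIso_fineSelmerDual)
    (h714 : thm714_sharpFlatSelmerDual_finite_torsion) :
    ∀ (W : WeierstrassCurve ℚ) [W.IsElliptic] [W.IsGloballyMinimal] (p : ℕ) [Fact p.Prime]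
      [ContinuousSMul ℤ_[p] (W.tateModule p)] [Module.Free ℤ_[p] (W.tateModule p)]
      [Module.Finite ℤ_[p] (W.tateModule p)],
      ClassX8 W p → ∀ (κ : ZpExtension ℚ p) (γ : Field.absoluteGaloisGroup ℚ),
      κ.IsCyclotomic → κ.IsTopGenerator γ → IsCyclotomicVariable p γ →
    ∀ (v : HeightOneSpectrum (𝓞 ℚ)), (p : 𝓞 ℚ) ∈ v.asIdeal →
    ∀ (g : Field.absoluteGaloisGroup (v.adicCompletion ℚ)),
      κ.IsTopGenerator (resGalOfEmb (closureEmb (K := ℚ) (v.adicCompletion ℚ)) g) →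
    ∀ (cneg : localPoints W (v.adicCompletion ℚ)) (c : ℕ → localPoints W (v.adicCompletion ℚ)),
      IsHondaSystem κ (closureEmb (K := ℚ) (v.adicCompletion ℚ)) W (W.frobeniusTrace p) g cneg c →
    ∀ (N : ℕ) (_ : NeZero N) (f : CuspForm (Gamma0 N) 2) (ϖ : ℚ) (Lsharp Lflat : IwasawaAlgebra p),
      IsNewformOf W f → (ϖ : ℝ) * W.realPeriodRat = plusPeriod f →
      IsSprungPair f p (W.frobeniusTrace p) Lsharp Lflat →
    ∀ (I : Kato2004.IwasawaH1Data W p κ γ)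
      (Cs : SharpFlatColemanKatoDataContra W p f ϖ κ γ (closureEmb (K := ℚ) (v.adicCompletion ℚ))
        (W.frobeniusTrace p) g c Chroma.sharp I)
      (Cf : SharpFlatColemanKatoDataContra W p f ϖ κ γ (closureEmb (K := ℚ) (v.adicCompletion ℚ))
        (W.frobeniusTrace p) g c Chroma.flat I),
      Cs.Z = Cf.Z →
    ∀ (Y' : W.FineSelmerDualData κ γ⁻¹) (𝔭 : PrimeSpectrum (IwasawaAlgebra p)), 𝔭.asIdeal.height = 1 →
      (p : IwasawaAlgebra p) ∉ 𝔭.asIdeal → (PowerSeries.X : IwasawaAlgebra p) ∉ 𝔭.asIdeal →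
      (∀ (col' : Chroma) (G' : IwasawaAlgebra p),
        iwasawaToPowerSeries p G' =
          PowerSeries.C (ϖ : ℚ_[p]) * iwasawaToPowerSeries p (chromaticL col' Lsharp Lflat) →
        G' ∈ 𝔭.asIdeal) →
      min (Module.lengthAt (IwasawaAlgebra p) (IwasawaAlgebra p ⧸ LinearMap.range Cs.colMap) 𝔭)
          (Module.lengthAt (IwasawaAlgebra p) (IwasawaAlgebra p ⧸ LinearMap.range Cf.colMap) 𝔭) ≤
        Module.lengthAt (IwasawaAlgebra p) Y'.X (PrimeSpectrum.comap (invol p).toRingHom 𝔭) := by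
  intro W _ _ p _ _ _ _ hX κ γ hκ hγ hcv v hv g hg cneg c hH N hN f ϖ Lsharp Lflat hnew _hϖ hSP I Cs Cf _hZ Y' 𝔭 h𝔭
    hp𝔭 hT𝔭 _hzero
  haveI := hN
  have hX' := hX
  obtain ⟨hp3, ⟨hgood, hss⟩, -⟩ := hX'
  subst hp3
  have hp2 : (3 : ℕ) ≠ 2 := by decide
  obtain ⟨Ds'⟩ := nonempty_sharpFlatSelmerDualData' W κ (closureEmb (K := ℚ) (v.adicCompletion ℚ))
    (W.frobeniusTrace 3) g c Chroma.sharp γ⁻¹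
  obtain ⟨Df'⟩ := nonempty_sharpFlatSelmerDualData' W κ (closureEmb (K := ℚ) (v.adicCompletion ℚ))
    (W.frobeniusTrace 3) g c Chroma.flat γ⁻¹
  -- `X♯(γ⁻¹)` is torsion by Thm. 7.14 at key `γ` (keying-immune), for `L♯ ≠ 0` on X8
  have hLs : chromaticL Chroma.sharp Lsharp Lflat ≠ 0 :=
    ChromaticBothColours.ClassX8.chromaticL_ne_zero W 3 hX f Lsharp Lflat hnew hSP Chroma.sharp
  obtain ⟨Ds⟩ := nonempty_sharpFlatSelmerDualData' W κ (closureEmb (K := ℚ) (v.adicCompletion ℚ))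
    (W.frobeniusTrace 3) g c Chroma.sharp γ
  have hDst : Module.IsTorsion (IwasawaAlgebra 3) Ds'.X :=
    (sharpFlatSelmerDualData_isTorsion_inv_iff Ds Ds').1
      (h714 W 3 hp2 hgood hss f hnew κ γ hκ hγ hcv v hv g hg cneg c hH Chroma.sharp Lsharp Lflat hSP hLs Ds).2
  -- `I.H ↪ Λ` by the `♯` Coleman–Kato map, and `I.H ≠ 0`
  have hφ : Function.Injective Cs.colMap := Cs.colMap_injective Lsharp Lflat hSP hLs
  have hI0 : Nontrivial I.H := nontrivial_iwasawaH1_of_contraPackage Cs Ds' hDst Y'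
  -- the `γ`-keyed twist `Y` of `Y'` is torsion (Thm. 7.14 via `X♯ ↠ X₀`), so `ℓ_𝔭 Y'.X = ℓ_{ι𝔭} Y.X < ⊤`
  obtain ⟨Y, -, -, -⟩ := Kato2004.fineSelmerDualData_exists_involTwist (inv_mul_cancel γ) Y'
  have hYt : Module.IsTorsion (IwasawaAlgebra 3) Y.X :=
    fineSelmerDualData_isTorsion_of_thm714 h714 W 3 hX hκ hγ hcv hv hg hH hnew hSP Y
  have hfin : Module.lengthAt (IwasawaAlgebra 3) Y'.X 𝔭 ≠ ⊤ := by
    haveI := WeierstrassCurve.FineSelmerDualData.module_finite W κ hγ Y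
    rw [Kato2004.fineSelmerDualData_lengthAt_inv_eq Y Y' 𝔭]
    exact IwasawaAlgebra.lengthAt_ne_top_of_isTorsion_of_height_le_one 3 Y.X hYt _
      ((Kato2004.height_comap_invol 𝔭).trans h𝔭).le
  -- (M1)-contra from the Poitou–Tate functional model, for THE CRUX'S `I` — no Kato 12.4
  obtain ⟨S', -, -, -⟩ := selmerDualData_exists_involTwist (mul_inv_cancel γ) (W.selmerDualData κ hγ)
  have hM1 := massCotorsion_contraFamily_of_poitouTate_of_injective hPT W 3 hX hκ hγ hv hg hH I Cs.colMap hφ hI0 S' Ds' Df' Y'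
    𝔭 h𝔭 hT𝔭
  -- (M2)-contra at the instance: `ℓ_𝔭 tors S'.X = ℓ_{ι𝔭} tors S.X = ℓ_𝔭 Y.X = ℓ_{ι𝔭} Y'.X` (Matar at `ι𝔭` for the twists)
  obtain ⟨S, -, -, -⟩ := selmerDualData_exists_involTwist (inv_mul_cancel γ) S'
  have h1 := lengthAt_torsion_selmerDual_eq_fine_comap_invol_of_matar_of_isTorsion hMatar W 3 (by decide) hgood hss hκ hγ
    S Y hYt (PrimeSpectrum.comap (invol 3).toRingHom 𝔭) (((Kato2004.height_comap_invol 𝔭).trans h𝔭).le)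
  rw [Kato2004.comap_invol_comap_invol, ← selmerDualData_lengthAt_torsion_inv_eq S S' 𝔭] at h1
  have hM2 : Module.lengthAt (IwasawaAlgebra 3) (Submodule.torsion (IwasawaAlgebra 3) S'.X) 𝔭 ≤
      Module.lengthAt (IwasawaAlgebra 3) Y'.X (PrimeSpectrum.comap (invol 3).toRingHom 𝔭) :=
    (h1.trans (Kato2004.fineSelmerDualData_lengthAt_eq_inv Y Y' 𝔭)).le
  exact min_lengthAt_cokernel_le_of_mass_contra Cs Cf Ds' Df' Y' 𝔭 hfin (hM1.trans (add_le_add le_rfl hM2))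

end ContraStub

end Summit.BirchSwinnertonDyer.BirchSwinnertonDyer.Theorems.ChromaticCommonZeros

end
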